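import Summits.AtomisticToContinuum.BoseEinsteinCondensation.Theses.BECClassicalWindow
import Summits.AtomisticToContinuum.BoseEinsteinCondensation.Theses.BECThermalBridge
import Summits.AtomisticToContinuum.BoseEinsteinCondensation.Theorems.BECClassicalWindowThermalGroundStateLimitPartition
import Summits.AtomisticToContinuum.BoseEinsteinCondensation.Theorems.BECClassicalWindowThermalGroundStateLimitLowTemperature
import Literature.MathematicalPhysics.QuantumManyBody.BoseGasCatStates
import Literature.MathematicalPhysics.QuantumManyBody.JelliumBoseGasProofs
import Literature.MathematicalPhysics.QuantumManyBody.BoseGasMergeOccupation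
import Literature.MathematicalPhysics.QuantumManyBody.NeumannMomentumCutoffs
import Literature.Barriers.AtomisticToContinuum.KineticGapLengthScalesAssembly

/-!
# Route `BECClassicalWindow` — support item `ThermalGroundStateLimit` (stmt-AtomisticToContinuum-9073)

Closes stmt-AtomisticToContinuum-9073 (exact signature of
`Summit.AtomisticToContinuum.BoseEinsteinCondensation.Theses.BECClassicalWindow.ThermalGroundStateLimit`,
shared verbatim by the sibling route `BECThermalBridge`): at fixed `N`, `L > 0`, `T₀ > 0` and `c`,
IF for every temperature `0 < T ≤ T₀` there is a slack `δ(T) > 0` such that every `δ`-near-Gibbs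
finite orthogonal ensemble `(pᵢ, Ψᵢ)` of Dirichlet trial states (near-minimiser of the free energy
`∑ pᵢ⟨Ψᵢ,HΨᵢ⟩ - T ∑(-pᵢ ln pᵢ)`, typed subtraction-free in `ℝ≥0∞`) has thermal constant-mode
occupation `∑ pᵢ ⟨φ₀, γ_{Ψᵢ} φ₀⟩ ≥ c`, THEN for every `c' < c` and every energy slack `δ' > 0`
some Dirichlet trial state `Ψ` has `⟨Ψ,HΨ⟩ ≤ E₀ + δ'` and `⟨φ₀, γ_Ψ φ₀⟩ ≥ c'`.

Proof (the planner's `β → ∞` step, run entirely on finite ensembles — no operators):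
1. `E₀ = ⊤` (jammed box): every ensemble has infinite energy, so the one-state ensemble of any
   trial state is near-Gibbs and the hypothesis applies to it directly.
2. `E₀ < ⊤`: the partition function is finite in ensemble form
   (`exists_sum_exp_neg_energy_le`: Parseval + Bessel mode counting on the torus of side `L`), so
   by Gibbs' inequality the free energy is bounded below (`freeEnergy_ge`) and near-Gibbs ensembles
   exist at every slack (`FiniteEnsemble.exists_isNearGibbs`). At a temperature
   `T ≍ δ'(c - c')/N` an `ε`-near-Gibbs ensemble puts weight `q ≤ 3(c-c')/(8(N+1))` on states of
   energy `> E₀ + δ'` (`mul_sum_weights_high_le`), while its mean occupation is `≥ c` by hypothesis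
   and every occupation is `≤ N` (`occupation_boxConstantMode_le`); by pigeonhole some state of
   positive weight and energy `≤ E₀ + δ'` has occupation `≥ c'`.
-/

noncomputable section

namespace Summit.AtomisticToContinuum.BoseEinsteinCondensation.Theorems

open MeasureTheory Filter Set Complex
open scoped ENNReal NNReal Topology ComplexConjugate BigOperators
open Literature.MathematicalPhysics.QuantumManyBody.BoseGas
open Literature.MathematicalPhysics.QuantumManyBody
open Literature.MathematicalPhysics.QuantumManyBody.FiniteEnsemble

namespace ThermalGroundStateLimit

variable {N : ℕ} {L : ℝ}

/-! ### Trial states exist; occupations are bounded by `N` -/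

/-- For `N = 0` the configuration space is a point of mass one and the constant `1` is an
admissible trial state; for `N ≥ 1` see `TrialState.nonempty`. Hence admissible trial states exist
for every `N` as soon as `L > 0`. [folklore] -/
theorem nonempty_trialState (N : ℕ) (hL : 0 < L) : Nonempty (TrialState N L) := by
  rcases Nat.eq_zero_or_pos N with hN | hN
  · subst hN
    refine ⟨⟨fun _ => 1, contDiff_const, fun X hX => absurd (fun i => Fin.elim0 i) hX,
      fun σ X => rfl, ?_⟩⟩
    have hvol : (volume : Measure (Config 0)) = Measure.dirac (fun i => Fin.elim0 i) := by
      rw [volume_pi, Measure.pi_of_empty _ (fun i => Fin.elim0 i)]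
    rw [hvol, lintegral_dirac]
    simp
  · exact TrialState.nonempty hN hL

/-- **`⟨φ₀, γ_Ψ φ₀⟩ ≤ N`** for the constant mode `φ₀ = L^{-3/2} 1_{Λ_L}` of the box and every
Dirichlet trial state: `φ₀` agrees a.e. with the constant mode of the cell, against which the
occupation of `Ψ` is the condensate occupation of its periodisation, bounded by `N`
(`condensateOccupation_le_card`). [cite: LSSY2005, Ch. 5 (5.17)] -/
theorem occupation_boxConstantMode_le (hL : 0 < L) (Ψ : TrialState N L) :
    occupation N (boxConstantMode L) Ψ.ψ ≤ (N : ℝ≥0∞) := by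
  have hae : boxConstantMode L =ᵐ[volume] constantMode L := by
    unfold boxConstantMode constantMode
    exact indicator_ae_eq_of_ae_eq_set (NeumannBox.box_ae_eq_cell L)
  rw [occupation_congr_ae hae, ← indicator_cellN_periodize Ψ hL]
  exact Literature.Barriers.AtomisticToContinuum.BoseGas.condensateOccupation_le_card hL
    (Ψ.toPeriodic hL le_rfl)

/-! ### The jammed case `E₀ = ⊤` -/

/-- If `E₀ = ⊤` every admissible ensemble has infinite energy average. [folklore] -/
theorem average_energy_eq_top {v : ℝ → ℝ≥0∞} (hE₀ : groundStateEnergy v N L = ⊤) {m : ℕ}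
    {p : Fin m → ℝ} {Ψ : Fin m → TrialState N L} (hE : IsEnsemble TrialState.IsOrthogonal p Ψ) :
    average (energy v) p Ψ = ⊤ := by
  obtain ⟨j, hj⟩ : ∃ j, 0 < p j := by
    by_contra h
    push Not at h
    have h1 := hE.sum_eq_one
    have h0 : ∑ j, p j ≤ 0 := Finset.sum_nonpos fun j _ => h j
    linarith
  have hEj : energy v (Ψ j) = ⊤ :=
    top_unique (hE₀ ▸ groundStateEnergy_le_energy v (Ψ j))
  unfold FiniteEnsemble.average
  refine top_unique ?_
  calc (⊤ : ℝ≥0∞) = ENNReal.ofReal (p j) * energy v (Ψ j) := by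
        rw [hEj, ENNReal.mul_top (ENNReal.ofReal_pos.2 hj).ne']
    _ ≤ ∑ i, ENNReal.ofReal (p i) * energy v (Ψ i) :=
        Finset.single_le_sum (f := fun i => ENNReal.ofReal (p i) * energy v (Ψ i))
          (fun i _ => zero_le) (Finset.mem_univ j)

/-- If `E₀ = ⊤` the one-state ensemble of any trial state is near-Gibbs at every temperature and
slack. [folklore] -/
theorem isNearGibbs_single_of_top {v : ℝ → ℝ≥0∞} (hE₀ : groundStateEnergy v N L = ⊤) (T δ : ℝ)
    (Ψ₀ : TrialState N L) :
    IsNearGibbs (energy v) TrialState.IsOrthogonal T δ (fun _ : Fin 1 => (1 : ℝ)) fun _ => Ψ₀ := by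
  refine ⟨isEnsemble_single _ Ψ₀, fun m' p' Ψ' hE' => ?_⟩
  rw [average_energy_eq_top hE₀ hE', top_add]
  exact le_top

/-! ### The main theorem -/

/-- **The `β → ∞` step, near-Gibbs form.** Fix `N`, `L > 0`, `T₀ > 0`, `c`. If for every
`0 < T ≤ T₀` there is `δ > 0` such that every `δ`-near-Gibbs finite orthogonal ensemble of
Dirichlet trial states at temperature `T` has mean constant-mode occupation `≥ c`, then for every
`c' < c` and `δ' > 0` some trial state has energy `≤ E₀ + δ'` and constant-mode occupation `≥ c'`.
[folklore] -/
theorem exists_lowEnergy_occupation_ge (v : ℝ → ℝ≥0∞) (hL : 0 < L) {T₀ : ℝ} (hT₀ : 0 < T₀)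
    {c : ℝ}
    (H : ∀ T : ℝ, 0 < T → T ≤ T₀ → ∃ δ : ℝ, 0 < δ ∧
      ∀ (m : ℕ) (p : Fin m → ℝ) (Ψ : Fin m → TrialState N L),
        IsNearGibbs (energy v) TrialState.IsOrthogonal T δ p Ψ →
          ENNReal.ofReal c ≤ average (fun Ψ => occupation N (boxConstantMode L) Ψ.ψ) p Ψ)
    {c' : ℝ} (hc' : c' < c) {δ' : ℝ≥0∞} (hδ' : 0 < δ') :
    ∃ Ψ : TrialState N L, energy v Ψ ≤ groundStateEnergy v N L + δ' ∧
      ENNReal.ofReal c' ≤ occupation N (boxConstantMode L) Ψ.ψ := by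
  classical
  obtain ⟨Ψ₀⟩ := nonempty_trialState N hL
  set E₀ := groundStateEnergy v N L with hE₀def
  by_cases hE₀ : E₀ = ⊤
  · -- jammed box: the hypothesis applies to the one-state ensemble of `Ψ₀`
    obtain ⟨δ, -, hH⟩ := H T₀ hT₀ le_rfl
    have hocc := hH 1 _ _ (isNearGibbs_single_of_top hE₀ T₀ δ Ψ₀)
    rw [average_single] at hocc
    refine ⟨Ψ₀, ?_, (ENNReal.ofReal_le_ofReal hc'.le).trans hocc⟩
    rw [hE₀, top_add]
    exact le_top
  -- near-minimisers of the energy exist at every slack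
  have hexists : ∀ θ : ℝ≥0∞, 0 < θ → ∃ Ψ : TrialState N L, energy v Ψ ≤ E₀ + θ := fun θ hθ => by
    obtain ⟨Ψ, hΨ⟩ := iInf_lt_iff.1 (ENNReal.lt_add_right hE₀ hθ.ne')
    exact ⟨Ψ, hΨ.le⟩
  -- reduce to a finite slack `δ₁ = min δ' 1`
  set δ₁ : ℝ≥0∞ := min δ' 1 with hδ₁
  have hδ₁pos : 0 < δ₁ := lt_min hδ' one_pos
  have hδ₁top : δ₁ ≠ ⊤ := ne_top_of_le_ne_top ENNReal.one_ne_top (min_le_right _ _)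
  suffices h : ∃ Ψ : TrialState N L, energy v Ψ ≤ E₀ + δ₁ ∧
      ENNReal.ofReal c' ≤ occupation N (boxConstantMode L) Ψ.ψ by
    obtain ⟨Ψ, h1, h2⟩ := h
    exact ⟨Ψ, h1.trans (add_le_add le_rfl (min_le_left _ _)), h2⟩
  -- trivial if `c' ≤ 0`
  by_cases hc'0 : c' ≤ 0
  · obtain ⟨Ψ, hΨ⟩ := hexists δ₁ hδ₁pos
    exact ⟨Ψ, hΨ, by rw [ENNReal.ofReal_of_nonpos hc'0]; exact zero_le⟩
  push Not at hc'0
  set g : ℝ := c - c' with hg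
  have hgpos : 0 < g := sub_pos.2 hc'
  set δr : ℝ := δ₁.toReal with hδr
  have hδrpos : 0 < δr := ENNReal.toReal_pos hδ₁pos.ne' hδ₁top
  have hδr1 : ENNReal.ofReal δr = δ₁ := ENNReal.ofReal_toReal hδ₁top
  -- the partition bound and the parameters
  obtain ⟨Z, hZ1, hZ⟩ := exists_sum_exp_neg_energy_le hL v N
  set ℓ : ℝ := E₀.toReal + Real.log Z with hℓ
  have hℓ0 : 0 ≤ ℓ := add_nonneg ENNReal.toReal_nonneg (Real.log_nonneg hZ1)
  set η : ℝ := δr * g / (16 * ((N : ℝ) + 1)) with hη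
  have hηpos : 0 < η := by positivity
  set T : ℝ := min (min T₀ (1 / 2)) (η / (ℓ + 1)) with hT
  have hTpos : 0 < T := lt_min (lt_min hT₀ (by norm_num)) (by positivity)
  have hTT₀ : T ≤ T₀ := (min_le_left _ _).trans (min_le_left _ _)
  have hT2 : T ≤ 1 / 2 := (min_le_left _ _).trans (min_le_right _ _)
  have hTℓ : T * ℓ ≤ η := by
    have h1 : T ≤ η / (ℓ + 1) := min_le_right _ _
    rw [le_div_iff₀ (by positivity)] at h1
    nlinarith
  obtain ⟨δT, hδT, hH⟩ := H T hTpos hTT₀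
  set ε : ℝ := min η δT with hε
  have hεpos : 0 < ε := lt_min hηpos hδT
  have hεη : ε ≤ η := min_le_left _ _
  -- an `ε`-near-Gibbs ensemble exists (free energy bounded below), and has mean occupation `≥ c`
  obtain ⟨m, p, Ψ, hG⟩ := exists_isNearGibbs hTpos.le (isEnsemble_single TrialState.IsOrthogonal Ψ₀)
    (B := -Real.log Z) (U := energy v)
    (fun m p Ψ hE hA => freeEnergy_ge hZ1 hZ hTpos (hT2.trans (by norm_num)) m p Ψ hE hA) hεpos
  have hEns := hG.isEnsemble
  have hocc : ENNReal.ofReal c ≤ average (fun Ψ => occupation N (boxConstantMode L) Ψ.ψ) p Ψ :=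
    hH m p Ψ (hG.mono (min_le_right _ _))
  -- concentration: the weight `q` of the states of energy `> E₀ + δ₁` is small
  obtain ⟨Φ, hΦ⟩ := hexists (ENNReal.ofReal η) (ENNReal.ofReal_pos.2 hηpos)
  have hconc := mul_sum_weights_high_le hE₀ hZ1 hZ hTpos hT2 hεpos.le hηpos.le hΦ hG hδrpos
  rw [hδr1] at hconc
  set Hs := Finset.univ.filter (fun i => 0 < p i ∧ E₀ + δ₁ < energy v (Ψ i)) with hHs
  set q : ℝ := ∑ i ∈ Hs, p i with hq
  have hq0 : 0 ≤ q := Finset.sum_nonneg fun i _ => hEns.nonneg i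
  have hq : (N : ℝ) * q ≤ 3 * g / 8 := by
    have h1 : δr * q ≤ 6 * η := by
      calc δr * q ≤ 2 * (η + ε) + 2 * T * (E₀.toReal + Real.log Z) := hconc
        _ ≤ 2 * (η + η) + 2 * η := by rw [← hℓ]; nlinarith
        _ = 6 * η := by ring
    have h2 : q ≤ 6 * g / (16 * ((N : ℝ) + 1)) := by
      rw [le_div_iff₀ (by positivity)]
      have : δr * q * (16 * ((N : ℝ) + 1)) ≤ 6 * (δr * g) := by
        calc δr * q * (16 * ((N : ℝ) + 1)) ≤ 6 * η * (16 * ((N : ℝ) + 1)) := by gcongr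
          _ = 6 * (δr * g) := by rw [hη]; field_simp
      nlinarith
    calc (N : ℝ) * q ≤ (N : ℝ) * (6 * g / (16 * ((N : ℝ) + 1))) := by gcongr
      _ = 3 * g / 8 * ((N : ℝ) / ((N : ℝ) + 1)) := by field_simp; ring
      _ ≤ 3 * g / 8 * 1 := by
          gcongr
          rw [div_le_one (by positivity)]
          linarith
      _ = 3 * g / 8 := mul_one _
  -- pigeonhole: some state of positive weight and energy `≤ E₀ + δ₁` has occupation `≥ c'`
  by_contra hcon
  push Not at hcon
  -- every state is either high-energy, or has occupation `< c'`, or has weight zero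
  set occ : Fin m → ℝ≥0∞ := fun i => occupation N (boxConstantMode L) (Ψ i).ψ with hoccdef
  have hoccN : ∀ i, occ i ≤ (N : ℝ≥0∞) := fun i => occupation_boxConstantMode_le hL (Ψ i)
  have hocctop : ∀ i, occ i ≠ ⊤ := fun i => ne_top_of_le_ne_top (ENNReal.natCast_ne_top N) (hoccN i)
  have hterm : ∀ i, p i * (occ i).toReal ≤ p i * c' + (N : ℝ) * (if i ∈ Hs then p i else 0) := by
    intro i
    rcases (hEns.nonneg i).eq_or_lt with hpi | hpi
    · rw [← hpi]; simp
    by_cases hi : i ∈ Hs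
    · rw [if_pos hi]
      have h1 : (occ i).toReal ≤ N := by
        have := ENNReal.toReal_mono (ENNReal.natCast_ne_top N) (hoccN i)
        rwa [ENNReal.toReal_natCast] at this
      nlinarith [mul_le_mul_of_nonneg_left h1 hpi.le]
    · rw [if_neg hi, mul_zero, add_zero]
      have hlow : energy v (Ψ i) ≤ E₀ + δ₁ := by
        rw [hHs, Finset.mem_filter] at hi
        push Not at hi
        exact hi (Finset.mem_univ i) hpi
      have hlt : occ i < ENNReal.ofReal c' := hcon (Ψ i) hlow
      have h2 : (occ i).toReal < c' := ENNReal.toReal_lt_of_lt_ofReal hlt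
      exact mul_le_mul_of_nonneg_left h2.le hpi.le
  have havg : (average (fun Ψ => occupation N (boxConstantMode L) Ψ.ψ) p Ψ).toReal =
      ∑ i, p i * (occ i).toReal := by
    unfold FiniteEnsemble.average
    rw [ENNReal.toReal_sum fun i _ => ENNReal.mul_ne_top ENNReal.ofReal_ne_top (hocctop i)]
    refine Finset.sum_congr rfl fun i _ => ?_
    rw [ENNReal.toReal_mul, ENNReal.toReal_ofReal (hEns.nonneg i)]
  have havgtop : average (fun Ψ => occupation N (boxConstantMode L) Ψ.ψ) p Ψ ≠ ⊤ := by
    unfold FiniteEnsemble.average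
    exact ENNReal.sum_ne_top.2 fun i _ => ENNReal.mul_ne_top ENNReal.ofReal_ne_top (hocctop i)
  have hcle : c ≤ ∑ i, p i * (occ i).toReal := by
    rw [← havg]
    exact (ENNReal.ofReal_le_iff_le_toReal havgtop).1 hocc
  have hsum : ∑ i, p i * (occ i).toReal ≤ c' + (N : ℝ) * q := by
    calc ∑ i, p i * (occ i).toReal ≤ ∑ i, (p i * c' + (N : ℝ) * (if i ∈ Hs then p i else 0)) :=
          Finset.sum_le_sum fun i _ => hterm i
      _ = c' + (N : ℝ) * q := by
          rw [Finset.sum_add_distrib, ← Finset.sum_mul, hEns.sum_eq_one, one_mul, ← Finset.mul_sum,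
            Finset.sum_ite_mem, Finset.univ_inter]
  have : c ≤ c' + 3 * g / 8 := hcle.trans (hsum.trans (by linarith))
  rw [hg] at this hgpos
  linarith

end ThermalGroundStateLimit

open ThermalGroundStateLimit Literature.MathematicalPhysics.QuantumManyBody.FiniteEnsemble in
/-- **`ThermalGroundStateLimit` holds** (stmt-AtomisticToContinuum-9073; the `β → ∞` step of the
routes `BECClassicalWindow` / `BECThermalBridge`, at fixed `N` and `L > 0`): a constant-mode
occupation bound `≥ c` valid for all near-Gibbs finite orthogonal ensembles of Dirichlet trial
states at all temperatures `0 < T ≤ T₀` is inherited, for every `c' < c`, by some near-minimiser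
of the ENERGY at every slack `δ' > 0`. The route's curried near-minimiser clause is
`FiniteEnsemble.IsNearGibbs (energy v) TrialState.IsOrthogonal T δ` (`isNearGibbs_iff`), and the
statement is `ThermalGroundStateLimit.exists_lowEnergy_occupation_ge`. [folklore] -/
theorem thermalGroundStateLimit_proof :
    Summit.AtomisticToContinuum.BoseEinsteinCondensation.Theses.BECClassicalWindow.ThermalGroundStateLimit := by
  intro v _hv N L T₀ c hL hT₀ H c' hc' δ' hδ'
  refine exists_lowEnergy_occupation_ge v hL hT₀ (fun T hT hTT₀ => ?_) hc' hδ'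
  obtain ⟨δ, hδ, h⟩ := H T hT hTT₀
  refine ⟨δ, hδ, fun m p Ψ hG => ?_⟩
  rw [isNearGibbs_iff] at hG
  exact h m p Ψ hG.1.1 hG.1.2.1 hG.1.2.2 hG.2

/-- The verbatim twin `ThermalGroundStateLimit` of route `BECThermalBridge` holds as well (same
statement, same proof). [folklore] -/
theorem thermalGroundStateLimit_proof_thermalBridge :
    Summit.AtomisticToContinuum.BoseEinsteinCondensation.Theses.BECThermalBridge.ThermalGroundStateLimit :=
  thermalGroundStateLimit_proof

end Summit.AtomisticToContinuum.BoseEinsteinCondensation.Theorems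

end
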